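import Literature.Analysis.FluidPDE.GloballyDissipativeEulerInduction
import HarnessLib

/-!
# De Lellis–Kwon 2022, Thm. 1.1: decomposition into its inductive proposition (Prop. 2.3)

Decomposition record (librarian, mode `fact-decompose`, 2026-08-16) for the XL named fact
`Literature.Analysis.FluidPDE.Torus.DeLellisKwon2022_thm11` (`GloballyDissipativeEuler`; C. De
Lellis, H. Kwon, *On nonuniqueness of Hölder continuous globally dissipative Euler flows*, Anal.
PDE 15 (2022) 2003–2059 = arXiv:2006.06482, Thm. 1.1: for every `β < 1/7` and `T > 0` a globally
dissipative weak Euler flow in `C^β([0,T] × T³)` whose kinetic energy strictly drops).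

**Decision: SPLIT, one child (new named fact) + proved glue.** The printed proof is "Prop. 2.3
(the convex-integration step, §§3–11) iterated from the starting tuple of §2.3, then the limit
step of §2.2". The tree proves everything except Prop. 2.3: the starting tuple and its estimates
(`GloballyDissipativeEulerStart`, `DLK.InductiveHypothesis.start`), the energy loss
(`DLK.exists_energyLoss`), the induction (`DLK.exists_iterationSequence_of_step`), the
interpolation bookkeeping and the limit step (`GloballyDissipativeEulerIteration`,
`GloballyDissipativeEulerLimit`, `GloballyDissipativeEulerProofs`), assembled in
`DLK.deLellisKwon2022_thm11_of_inductiveProposition`, whose single hypothesis is Prop. 2.3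
transcribed with its printed quantifier structure. This file names that hypothesis:

* child (new): `DLK.DeLellisKwon2022_prop23` — **Proposition 2.3** (the inductive proposition),
  verbatim the hypothesis `hprop` of `DLK.deLellisKwon2022_thm11_of_inductiveProposition`;
* glue (proved): `Torus.DeLellisKwon2022_thm11_holds_of : DLK.DeLellisKwon2022_prop23 →
  Torus.DeLellisKwon2022_thm11`.

The child does not restate the parent: it is a one-step statement about dissipative
Euler–Reynolds flows (Def. 2.1, `Torus.IsDissipativeEulerReynoldsOn`) and the inductive estimates
(2.4)–(2.10) (`DLK.InductiveHypothesis`, `DLK.EnergyLossHypothesis`), with no limit object, no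
Hölder class and no energy inequality. Its own printed proof (§§3–11: mollification, gluing,
Mikado-flow perturbation with the new local-energy-flux bookkeeping) is served in the tree by the
`Mikado*` files (building blocks, supports, direction families) — the live line of the fact's seat.

## References

* C. De Lellis, H. Kwon, Anal. PDE 15 (2022) 2003–2059 = arXiv:2006.06482: Prop. 2.3 (§2.1,
  p. 7 of the arXiv version), §2.1 (2.4)–(2.10), §2.3 (proof of Thm. 1.1), §4.2 (`p_{q+1} = p_q`).
  [DelellisKwon2022]
-/

noncomputable section

open MeasureTheory Set Filter Function UnitAddTorus
open scoped ENNReal NNReal InnerProductSpace RealInnerProductSpace ContDiff Topology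

namespace Literature.Analysis.FluidPDE

namespace DLK

open FunctionSpaces FunctionSpaces.Torus BDSV

/-- **De Lellis–Kwon 2022, Proposition 2.3 (inductive proposition)** — named fact, the single
remaining input of `Torus.DeLellisKwon2022_thm11` in the tree. Printed (arXiv:2006.06482, §2.1):
"There exists a geometric constant `M > 1` and functions `b̄(α) > 1` and `Λ₀(α, b, M) > 0` such
that the following property holds. Let `α ∈ (0, 1/7)`, `b ∈ (1, b̄(α))` and `λ₀ ≥ Λ₀(α, b, M)`
and assume that a tuple `(v_q, p_q, R_q, κ_q, φ_q)` is a dissipative Euler–Reynolds flow defined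
on the time interval `[0,T] + τ_{q-1}` satisfying (2.4)–(2.8) for an energy loss `E(t)` satisfying
(2.9). Then, we can find a corrected dissipative Euler–Reynolds flow
`(v_{q+1}, p_{q+1}, R_{q+1}, κ_{q+1}, φ_{q+1})` on the time interval `[0,T] + τ_q` for the same
energy loss `E(t)` which satisfies (2.4)–(2.8) for `q+1` and
`‖v_{q+1} - v_q‖₀ + λ_{q+1}⁻¹‖v_{q+1} - v_q‖₁ ≤ M δ_{q+1}^{1/2}`" (2.10). Lean reading, verbatim the
hypothesis `hprop` of `DLK.deLellisKwon2022_thm11_of_inductiveProposition`: the frequency parameter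
is `a` (`λ_q = 2π⌈a^{b^q}⌉ = BDSV.freq a b q`, `δ_q = BDSV.amp α a b q`), dissipative Euler–Reynolds
flows are `Torus.IsDissipativeEulerReynoldsOn` (Def. 2.1), (2.4)–(2.8) are
`DLK.InductiveHypothesis`, (2.9) is `DLK.EnergyLossHypothesis`, the time domains `[0,T] + τ_{q-1}`
are any sets `S_q ⊇ [0,T]` with `S₀ = ℝ` (`τ₋₁ = ∞`), (2.10) is split into its sup and
first-derivative parts, and the pressure is kept, `p_{q+1} = p_q` (§4.2). Proved in print by the
convex-integration construction of §§3–11 (mollification §4, gluing §§5–6, Mikado perturbation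
and the local energy flux §§7–10, conclusion §11). Size L (one induction step; the tree has the
Mikado building blocks). [cite: DelellisKwon2022, Proposition 2.3 (§2.1) with §4.2] -/
def DeLellisKwon2022_prop23 : Prop :=
  ∃ M : ℝ, 1 < M ∧ ∀ α : ℝ, 0 < α → α < 1 / 7 → ∃ bbar : ℝ, 1 < bbar ∧
    ∀ b : ℝ, 1 < b → b < bbar → ∃ Λ₀ : ℝ, ∀ a : ℝ, Λ₀ ≤ a → ∀ T : ℝ, 0 < T →
      ∀ E : ℝ → ℝ, EnergyLossHypothesis α a b E →
        ∃ S : ℕ → Set ℝ, S 0 = univ ∧ (∀ q, Icc 0 T ⊆ S q) ∧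
          ∀ (q : ℕ) (v : ℝ → UnitAddTorus (Fin 3) → EuclideanSpace ℝ (Fin 3))
            (p : ℝ → UnitAddTorus (Fin 3) → ℝ)
            (R : ℝ → UnitAddTorus (Fin 3) → Fin 3 → EuclideanSpace ℝ (Fin 3))
            (κ : ℝ → UnitAddTorus (Fin 3) → ℝ) (φ : ℝ → UnitAddTorus (Fin 3) → EuclideanSpace ℝ (Fin 3)),
            Torus.IsDissipativeEulerReynoldsOn (S q) v p R κ φ E →
            InductiveHypothesis M α a b (S q) q v p R φ →
            ∃ (v' : ℝ → UnitAddTorus (Fin 3) → EuclideanSpace ℝ (Fin 3))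
              (p' : ℝ → UnitAddTorus (Fin 3) → ℝ)
              (R' : ℝ → UnitAddTorus (Fin 3) → Fin 3 → EuclideanSpace ℝ (Fin 3))
              (κ' : ℝ → UnitAddTorus (Fin 3) → ℝ) (φ' : ℝ → UnitAddTorus (Fin 3) → EuclideanSpace ℝ (Fin 3)),
              Torus.IsDissipativeEulerReynoldsOn (S (q + 1)) v' p' R' κ' φ' E ∧
              InductiveHypothesis M α a b (S (q + 1)) (q + 1) v' p' R' φ' ∧
              (∀ t ∈ S (q + 1), ∀ x, ‖v' t x - v t x‖ ≤ M * Real.sqrt (amp α a b (q + 1))) ∧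
              (∀ i, ∀ t ∈ S (q + 1), ∀ x,
                ‖Torus.partialDeriv i (fun y => v' t y - v t y) x‖ ≤
                  M * freq a b (q + 1) * Real.sqrt (amp α a b (q + 1))) ∧
              (∀ t ∈ S (q + 1), ∀ x, p' t x = p t x)

end DLK

namespace Torus

/-- **Glue of the decomposition of `Torus.DeLellisKwon2022_thm11`**: Thm. 1.1 follows from its
single child, Prop. 2.3 (`DLK.DeLellisKwon2022_prop23`), by the tree's
`DLK.deLellisKwon2022_thm11_of_inductiveProposition` (parameter choice of §2.3, energy loss,
starting tuple, induction and the limit step of §2.2, all proved).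
[cite: DelellisKwon2022, Thm. 1.1 (proof, §2.3) and Prop. 2.3] -/
theorem DeLellisKwon2022_thm11_holds_of (h : DLK.DeLellisKwon2022_prop23) :
    DeLellisKwon2022_thm11 :=
  DLK.deLellisKwon2022_thm11_of_inductiveProposition h

end Torus

end Literature.Analysis.FluidPDE

end
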